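import Mathlib.GroupTheory.Perm.Basic
import Mathlib.Logic.Equiv.Basic
import Mathlib.Data.Fintype.BigOperators
import Mathlib.Data.Fintype.Perm
import Mathlib.Algebra.BigOperators.Fin
import Mathlib.Algebra.Order.BigOperators.Ring.Finset
import Mathlib.Analysis.SpecialFunctions.Exp
import HarnessLib

/-!
# The Fisher–Yates (Knuth) shuffle driven by random words: every permutation is (almost) equally likely

Topic `Combinatorics/Enumerative`. The in-place shuffle of an array of length `N`
(Knuth, TAOCP Vol. 2, §3.4.2, Algorithm P; Durstenfeld 1964; Fisher–Yates 1938), in the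
front-to-back form a word RAM executes with one random word per position:

  for `i = 0, …, N-2`: `j := i + (c_i mod (N - i))`; swap the entries at positions `i` and `j`,

where `c_0, …, c_{N-2}` are the random words. As a permutation of the positions the result is the
ordered product `swap(0, j_0) ∘ swap(1, j_1) ∘ ⋯ ∘ swap(N-2, j_{N-2})` (`fisherYates N c`).

* `swapProd_injective` / `exists_eq_swapProd`: the map `(j_0, …, j_{N-2}) ↦ ∏ swap(i, j_i)` from
  index sequences with `i ≤ j_i < N` to permutations is a bijection (Knuth loc. cit.: Algorithm P
  produces each of the `N!` permutations exactly once as `(j_i)` ranges over `∏ (N - i)` values);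
* `le_card_fisherYates_fiber`: consequently, when the `j_i` are produced from independent uniform
  words `c_i ∈ [M]` by `c_i mod (N - i)`, every permutation `τ` arises from at least
  `∏_{d=2}^{N} ⌊M/d⌋` word vectors;
* `card_filter_fisherYates_mem_ge`: for a set `G` of permutations, the fraction of word vectors
  whose shuffle lands in `G` is at least `(|G|/N!) · (1 - N²/M)` — the modulo bias costs at most a
  factor `1 - N²/M` (uniformity would be `|G|/N!`);
* `card_forall_not_mem_pow` and `one_sub_pow_le_third`: independent repetitions — among `Q`-tuples
  of blocks, those with no block in a set of density `≥ θ` number at most `((1-θ)·|α|)^Q`, and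
  `(1 - θ)^Q ≤ 1/3` once `θ Q ≥ 2`.

These are the sampling facts behind randomised word-RAM algorithms that need a uniformly random
relabelling (e.g. Pratt, STOC 2024, Thm. 1.9: "choose a permutation `σ ∈ 𝔖_{3n}` uniformly at
random … repeat this test `1/p` times").

## References

* [KnuthTAOCP2] D. E. Knuth, *The Art of Computer Programming, Vol. 2: Seminumerical Algorithms*,
  3rd ed., §3.4.2, Algorithm P (Shuffling) and the remark on its correctness.
* [Pratt2024SCC] K. Pratt, STOC 2024, arXiv:2311.02774, §2 (proof of Thm. 1.9).
-/

namespace Literature.Combinatorics.Enumerative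

open Finset Equiv

/-! ## The shuffle as a product of transpositions -/

/-- The transposition of positions `i` and `a` of `Fin N` (the identity if either is out of range).
[cite: KnuthTAOCP2, §3.4.2 Algorithm P] -/
def swapAt (N i a : ℕ) : Perm (Fin N) :=
  if h : i < N ∧ a < N then Equiv.swap (⟨i, h.1⟩ : Fin N) ⟨a, h.2⟩ else 1

/-- The ordered product `swapAt i₀ (j i₀) * swapAt (i₀+1) (j (i₀+1)) * ⋯` with `len` factors
(as a permutation of positions: first factor applied last). [cite: KnuthTAOCP2, §3.4.2 Algorithm P] -/
def swapProd (N : ℕ) (j : ℕ → ℕ) : ℕ → ℕ → Perm (Fin N)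
  | _, 0 => 1
  | i₀, len + 1 => swapAt N i₀ (j i₀) * swapProd N j (i₀ + 1) len

/-- **The Fisher–Yates / Knuth shuffle** driven by the words `c 0, …, c (N-2)`: position `i` is
swapped with position `i + (c i mod (N - i))`, for `i = 0, …, N - 2`; the resulting arrangement
of `0, …, N-1` as a permutation of positions (`a[x] = fisherYates N c x` when the array starts as
the identity). [cite: KnuthTAOCP2, §3.4.2 Algorithm P] -/
def fisherYates (N : ℕ) (c : ℕ → ℕ) : Perm (Fin N) :=
  swapProd N (fun i => i + c i % (N - i)) 0 (N - 1)

/-- `swapAt` is an involution. [folklore] -/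
theorem swapAt_mul_self (N i a : ℕ) : swapAt N i a * swapAt N i a = 1 := by
  unfold swapAt
  split_ifs with h
  · exact Equiv.swap_mul_self _ _
  · exact mul_one 1

/-- `swapAt i a` fixes every position other than `i` and `a`. [folklore] -/
theorem swapAt_apply_of_ne {N i a : ℕ} {x : Fin N} (hi : (x : ℕ) ≠ i) (ha : (x : ℕ) ≠ a) :
    swapAt N i a x = x := by
  unfold swapAt
  split_ifs with h
  · exact Equiv.swap_apply_of_ne_of_ne (fun e => hi (congrArg Fin.val e))
      (fun e => ha (congrArg Fin.val e))
  · rfl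

/-- `swapAt i a` sends `i` to `a`. [folklore] -/
theorem swapAt_apply_left {N i a : ℕ} (hi : i < N) (ha : a < N) :
    swapAt N i a ⟨i, hi⟩ = ⟨a, ha⟩ := by
  unfold swapAt
  rw [dif_pos ⟨hi, ha⟩]
  exact Equiv.swap_apply_left _ _

/-- `swapAt i a` sends `a` to `i`. [folklore] -/
theorem swapAt_apply_right {N i a : ℕ} (hi : i < N) (ha : a < N) :
    swapAt N i a ⟨a, ha⟩ = ⟨i, hi⟩ := by
  unfold swapAt
  rw [dif_pos ⟨hi, ha⟩]
  exact Equiv.swap_apply_right _ _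

/-- `swapProd N j i₀ len` only reads `j` at the indices `i₀, …, i₀ + len - 1`. [folklore] -/
theorem swapProd_congr {N : ℕ} {j j' : ℕ → ℕ} :
    ∀ {i₀ len : ℕ}, (∀ i, i₀ ≤ i → i < i₀ + len → j i = j' i) →
      swapProd N j i₀ len = swapProd N j' i₀ len
  | _, 0, _ => rfl
  | i₀, len + 1, h => by
    simp only [swapProd]
    rw [h i₀ le_rfl (by omega), swapProd_congr (fun i hi hi' => h i (by omega) (by omega))]

/-- If `i ≤ j i` for all relevant `i`, the product `swapProd N j i₀ len` fixes every position
below `i₀` (later swaps never touch earlier positions — the invariant of Algorithm P).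
[cite: KnuthTAOCP2, §3.4.2 Algorithm P] -/
theorem swapProd_apply_of_lt {N : ℕ} {j : ℕ → ℕ} :
    ∀ {i₀ len : ℕ}, (∀ i, i₀ ≤ i → i ≤ j i) → ∀ {x : Fin N}, (x : ℕ) < i₀ →
      swapProd N j i₀ len x = x
  | _, 0, _, _, _ => rfl
  | i₀, len + 1, hj, x, hx => by
    simp only [swapProd, Perm.mul_apply]
    rw [swapProd_apply_of_lt (fun i hi => hj i (by omega)) (by omega)]
    exact swapAt_apply_of_ne (by omega) (by have := hj i₀ le_rfl; omega)

/-- The first factor decides the image of `i₀`: `swapProd N j i₀ (len+1) i₀ = j i₀`.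
[cite: KnuthTAOCP2, §3.4.2 Algorithm P] -/
theorem swapProd_apply_self {N : ℕ} {j : ℕ → ℕ} {i₀ len : ℕ} (hj : ∀ i, i₀ ≤ i → i ≤ j i)
    (hi₀ : i₀ < N) (hji₀ : j i₀ < N) :
    swapProd N j i₀ (len + 1) ⟨i₀, hi₀⟩ = ⟨j i₀, hji₀⟩ := by
  simp only [swapProd, Perm.mul_apply]
  rw [swapProd_apply_of_lt (fun i hi => hj i (by omega)) (by simp), swapAt_apply_left]

/-- **Injectivity of Algorithm P**: index sequences with `i ≤ j i < N` that yield the same product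
of transpositions agree (read off `j i₀` as the image of `i₀`, cancel, and recurse).
[cite: KnuthTAOCP2, §3.4.2 Algorithm P] -/
theorem swapProd_injective {N : ℕ} {j j' : ℕ → ℕ} :
    ∀ {i₀ len : ℕ}, i₀ + len ≤ N →
      (∀ i, i₀ ≤ i → i < i₀ + len → i ≤ j i ∧ j i < N) →
      (∀ i, i₀ ≤ i → i < i₀ + len → i ≤ j' i ∧ j' i < N) →
      swapProd N j i₀ len = swapProd N j' i₀ len →
      ∀ i, i₀ ≤ i → i < i₀ + len → j i = j' i
  | _, 0, _, _, _, _, i, hi, hi' => by omega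
  | i₀, len + 1, hN, hj, hj', heq, i, hi, hi' => by
    -- pad `j`, `j'` outside the window so that `i ≤ j i` holds everywhere above `i₀`
    set J : ℕ → ℕ := fun i => if i < i₀ + (len + 1) then j i else i with hJ
    set J' : ℕ → ℕ := fun i => if i < i₀ + (len + 1) then j' i else i with hJ'
    have hJJ : swapProd N J i₀ (len + 1) = swapProd N j i₀ (len + 1) :=
      swapProd_congr fun i _ h => by simp [hJ, h]
    have hJJ' : swapProd N J' i₀ (len + 1) = swapProd N j' i₀ (len + 1) :=
      swapProd_congr fun i _ h => by simp [hJ', h]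
    have hJle : ∀ i, i₀ ≤ i → i ≤ J i := fun i hi => by
      simp only [hJ]; split_ifs with h
      · exact (hj i hi h).1
      · exact le_rfl
    have hJ'le : ∀ i, i₀ ≤ i → i ≤ J' i := fun i hi => by
      simp only [hJ']; split_ifs with h
      · exact (hj' i hi h).1
      · exact le_rfl
    have hi₀N : i₀ < N := by omega
    -- the images of `i₀` agree
    have h0 : j i₀ = j' i₀ := by
      have e1 := swapProd_apply_self (len := len) hJle hi₀N
        (show J i₀ < N by simp [hJ, (hj i₀ le_rfl (by omega)).2])
      have e2 := swapProd_apply_self (len := len) hJ'le hi₀N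
        (show J' i₀ < N by simp [hJ', (hj' i₀ le_rfl (by omega)).2])
      rw [hJJ] at e1
      rw [hJJ', ← heq, e1] at e2
      have e3 := congrArg Fin.val e2
      simp only [hJ, hJ'] at e3
      simpa using e3
    rcases Nat.eq_or_lt_of_le hi with rfl | hlt
    · exact h0
    -- cancel the first factor and recurse
    have heq' : swapProd N j (i₀ + 1) len = swapProd N j' (i₀ + 1) len := by
      have := heq
      simp only [swapProd] at this
      rw [h0] at this
      exact mul_left_cancel this
    exact swapProd_injective (i₀ := i₀ + 1) (len := len) (by omega)
      (fun i hi hi' => hj i (by omega) (by omega)) (fun i hi hi' => hj' i (by omega) (by omega))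
      heq' i hlt (by omega)

/-- A permutation of `Fin N` fixing every position below `N - 1` is the identity. [folklore] -/
theorem perm_eq_one_of_apply_lt {N : ℕ} (τ : Perm (Fin N))
    (h : ∀ x : Fin N, (x : ℕ) + 1 < N → τ x = x) : τ = 1 := by
  ext x
  by_cases hx : (x : ℕ) + 1 < N
  · rw [h x hx]; rfl
  · -- `x` is the last position; its image cannot be a fixed smaller position
    have hlast : (x : ℕ) = N - 1 := by omega
    by_contra hne
    have hne' : τ x ≠ x := fun e => hne (by rw [e]; rfl)
    have hlt : ((τ x : Fin N) : ℕ) + 1 < N := by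
      have := (τ x).2
      have : ((τ x : Fin N) : ℕ) ≠ x := fun e => hne' (Fin.ext e)
      omega
    have := h (τ x) hlt
    exact hne' (τ.injective this)

/-- **Surjectivity of Algorithm P**: every permutation fixing the positions below `i₀` is a product
`swapProd N j i₀ (N - 1 - i₀)` for an index sequence with `i ≤ j i < N`
(take `j i₀ := τ i₀`, compose with that transposition, and recurse). [cite: KnuthTAOCP2, §3.4.2 Algorithm P] -/
theorem exists_eq_swapProd {N : ℕ} :
    ∀ (d i₀ : ℕ), i₀ + d + 1 = N → ∀ τ : Perm (Fin N), (∀ x : Fin N, (x : ℕ) < i₀ → τ x = x) →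
      ∃ j : ℕ → ℕ, (∀ i, i₀ ≤ i → i < i₀ + d → i ≤ j i ∧ j i < N) ∧ τ = swapProd N j i₀ d
  | 0, i₀, hN, τ, hτ => by
    refine ⟨fun i => i, fun i hi hi' => by omega, ?_⟩
    rw [swapProd]
    exact perm_eq_one_of_apply_lt τ fun x hx => hτ x (by omega)
  | d + 1, i₀, hN, τ, hτ => by
    have hi₀ : i₀ < N := by omega
    set a : ℕ := ((τ ⟨i₀, hi₀⟩ : Fin N) : ℕ) with ha
    have haN : a < N := (τ ⟨i₀, hi₀⟩).2
    have hia : i₀ ≤ a := by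
      by_contra hlt
      have hlt : a < i₀ := Nat.lt_of_not_le hlt
      have e := hτ ⟨a, haN⟩ hlt
      have : (⟨a, haN⟩ : Fin N) = ⟨i₀, hi₀⟩ := τ.injective (e.trans (Fin.ext ha))
      have := Fin.mk.inj_iff.mp this
      omega
    -- `τ' := swapAt i₀ a * τ` fixes everything below `i₀ + 1`
    set τ' := swapAt N i₀ a * τ with hτ'
    have hτ'fix : ∀ x : Fin N, (x : ℕ) < i₀ + 1 → τ' x = x := by
      intro x hx
      simp only [hτ', Perm.mul_apply]
      rcases Nat.lt_or_ge (x : ℕ) i₀ with hlt | hge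
      · rw [hτ x hlt]
        exact swapAt_apply_of_ne (by omega) (by omega)
      · have hxe : x = ⟨i₀, hi₀⟩ := Fin.ext (by simp; omega)
        rw [hxe, show τ ⟨i₀, hi₀⟩ = ⟨a, haN⟩ from Fin.ext ha.symm, swapAt_apply_right hi₀ haN]
    obtain ⟨j', hj', hτ'eq⟩ := exists_eq_swapProd d (i₀ + 1) (by omega) τ' hτ'fix
    refine ⟨fun i => if i = i₀ then a else j' i, fun i hi hi' => ?_, ?_⟩
    · by_cases h : i = i₀
      · subst h; simp [hia, haN]
      · simp only [if_neg h]; exact hj' i (by omega) (by omega)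
    · have hj0 : (if i₀ = i₀ then a else j' i₀) = a := if_pos rfl
      rw [swapProd, hj0,
        swapProd_congr (j' := j') (fun i hi _ => by simp [show i ≠ i₀ by omega]), ← hτ'eq, hτ',
        ← mul_assoc, swapAt_mul_self, one_mul]

/-- Every permutation of `Fin N` is a Fisher–Yates product for some admissible index sequence
(`i ≤ j i < N` for `i < N - 1`). [cite: KnuthTAOCP2, §3.4.2 Algorithm P] -/
theorem exists_eq_swapProd_zero {N : ℕ} (hN : 1 ≤ N) (τ : Perm (Fin N)) :
    ∃ j : ℕ → ℕ, (∀ i, i < N - 1 → i ≤ j i ∧ j i < N) ∧ τ = swapProd N j 0 (N - 1) := by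
  obtain ⟨j, hj, h⟩ := exists_eq_swapProd (N - 1) 0 (by omega) τ (fun x hx => by omega)
  exact ⟨j, fun i hi => hj i (Nat.zero_le _) (by omega), h⟩

/-! ## Counting word vectors -/

/-- Residues: among `v < M`, at least `⌊M/d⌋` satisfy `v mod d = t` (for `t < d`): the values
`t, t + d, …, t + (⌊M/d⌋-1) d`. [folklore] -/
theorem div_le_card_filter_mod_eq (M d t : ℕ) (ht : t < d) :
    M / d ≤ #{v : Fin M | (v : ℕ) % d = t} := by
  have hd : 0 < d := by omega
  -- the injection `s ↦ t + s d`
  have hlt : ∀ s, s < M / d → t + s * d < M := by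
    intro s hs
    have h1 : (s + 1) * d ≤ M / d * d := Nat.mul_le_mul_right d hs
    have h2 : M / d * d ≤ M := Nat.div_mul_le_self M d
    nlinarith
  let f : Fin (M / d) → Fin M := fun s => ⟨t + s * d, hlt s s.2⟩
  have hf : Function.Injective f := by
    intro s s' h
    simp only [f, Fin.mk.injEq] at h
    exact Fin.ext (Nat.eq_of_mul_eq_mul_right hd (by omega))
  calc M / d = #(Finset.univ.image f) := by
        rw [Finset.card_image_of_injective _ hf]; simp
    _ ≤ #{v : Fin M | (v : ℕ) % d = t} := by
        refine Finset.card_le_card fun v hv => ?_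
        simp only [Finset.mem_image, Finset.mem_univ, true_and] at hv
        obtain ⟨s, rfl⟩ := hv
        simp [f, Nat.add_mul_mod_self_right, Nat.mod_eq_of_lt ht]

/-- Read a word vector `ρ : Fin (N-1) → Fin M` as the coin function of `fisherYates`. [folklore] -/
def coins {N M : ℕ} (ρ : Fin (N - 1) → Fin M) : ℕ → ℕ :=
  fun i => if h : i < N - 1 then (ρ ⟨i, h⟩ : ℕ) else 0

/-- **Every permutation has many preimages under the word-driven shuffle**: for `τ ∈ 𝔖_N` at
least `∏_{i < N-1} ⌊M/(N-i)⌋ = ∏_{d=2}^{N} ⌊M/d⌋` word vectors `ρ ∈ [M]^{N-1}` shuffle to `τ`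
(write `τ = ∏ swap(i, j_i)` by `exists_eq_swapProd_zero`; every `ρ` with
`ρ_i ≡ j_i - i (mod N-i)` works). [cite: KnuthTAOCP2, §3.4.2 Algorithm P] -/
theorem le_card_fisherYates_fiber {N : ℕ} (hN : 1 ≤ N) (M : ℕ) (τ : Perm (Fin N)) :
    ∏ i : Fin (N - 1), M / (N - i) ≤
      #{ρ : Fin (N - 1) → Fin M | fisherYates N (coins ρ) = τ} := by
  classical
  obtain ⟨j, hj, hτ⟩ := exists_eq_swapProd_zero hN τ
  -- the product set `R = ∏ R_i`, `R_i = {v | i + v % (N-i) = j i}`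
  let R : Fin (N - 1) → Finset (Fin M) := fun i => {v : Fin M | (i : ℕ) + (v : ℕ) % (N - i) = j i}
  have hR : ∀ i : Fin (N - 1), M / (N - i) ≤ #(R i) := by
    intro i
    have hji := hj i i.2
    have : R i = ({v : Fin M | (v : ℕ) % (N - i) = j i - i} : Finset (Fin M)) := by
      ext v; simp only [R, Finset.mem_filter, Finset.mem_univ, true_and]; omega
    rw [this]
    exact div_le_card_filter_mod_eq M (N - i) (j i - i) (by omega)
  -- `R ⊆ fiber`
  have hsub : (Finset.univ.pi fun i : Fin (N - 1) => R i).card ≤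
      #{ρ : Fin (N - 1) → Fin M | fisherYates N (coins ρ) = τ} := by
    let g : ((i : Fin (N - 1)) → i ∈ (Finset.univ : Finset (Fin (N - 1))) → Fin M) →
        (Fin (N - 1) → Fin M) := fun f i => f i (Finset.mem_univ i)
    have hg : Set.InjOn g ↑(Finset.univ.pi fun i : Fin (N - 1) => R i) := by
      intro f _ f' _ h
      funext i hi
      exact congrFun h i
    refine Finset.card_le_card_of_injOn g (fun f hf => ?_) hg
    have hf' := Finset.mem_pi.mp (Finset.mem_coe.mp hf)
    rw [Finset.mem_coe, Finset.mem_filter]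
    refine ⟨Finset.mem_univ _, ?_⟩
    rw [hτ, fisherYates]
    refine swapProd_congr fun i _ hi => ?_
    have hi' : i < N - 1 := by omega
    have := hf' ⟨i, hi'⟩ (Finset.mem_univ _)
    simp only [R, Finset.mem_filter, Finset.mem_univ, true_and] at this
    simp only [coins, dif_pos hi', g]
    exact this
  refine le_trans ?_ hsub
  rw [Finset.card_pi]
  exact Finset.prod_le_prod (fun _ _ => Nat.zero_le _) fun i _ => hR i

/-- `N! · ∏_{d=2}^{N} ⌊M/d⌋ ≥ (M - N)^{N-1}` for `N ≤ M` (each factor: `d ⌊M/d⌋ ≥ M - d + 1 ≥ M - N`).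
[folklore] -/
theorem pow_le_factorial_mul_prod_div {N M : ℕ} (hN : 1 ≤ N) (hNM : N ≤ M) :
    (M - N) ^ (N - 1) ≤ N.factorial * ∏ i : Fin (N - 1), M / (N - i) := by
  -- `∏_{i < N-1} (N - i) = N! ` (the factors are `N, N-1, …, 2`)
  have hfac : ∀ n : ℕ, ∏ i : Fin n, (n + 1 - i) = (n + 1).factorial := by
    intro n
    induction n with
    | zero => simp
    | succ n ih =>
      rw [Fin.prod_univ_succ, Nat.factorial_succ (n + 1)]
      simp only [Fin.val_zero, Nat.sub_zero, Fin.val_succ]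
      congr 1
      rw [← ih]
      exact Finset.prod_congr rfl fun i _ => by omega
  obtain ⟨n, rfl⟩ : ∃ n, N = n + 1 := ⟨N - 1, by omega⟩
  change (M - (n + 1)) ^ n ≤ (n + 1).factorial * ∏ i : Fin n, M / (n + 1 - (i : ℕ))
  rw [← hfac n, ← Finset.prod_mul_distrib, ← Fin.prod_const]
  refine Finset.prod_le_prod (fun _ _ => Nat.zero_le _) fun i _ => ?_
  -- `M - (n+1) ≤ (n+1-i) * (M / (n+1-i))`
  have hd : 0 < n + 1 - (i : ℕ) := by omega
  have h1 : M - (n + 1) + 1 ≤ (n + 1 - i) * (M / (n + 1 - i)) + (n + 1 - i) - (n - i) := by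
    have := Nat.lt_div_mul_add (a := M) hd
    have hi := i.2
    rw [mul_comm] at this
    omega
  omega

/-- **The word-driven shuffle is almost uniform, from below**: for any set `G` of permutations of
`Fin N` (`1 ≤ N ≤ M`), the number of word vectors `ρ ∈ [M]^{N-1}` whose shuffle lies in `G` is at
least `(|G| / N!) · (1 - N²/M) · M^{N-1}` (exact uniformity would give `|G|/N!`; the modulo bias
costs the factor `(1 - N/M)^{N-1} ≥ 1 - N²/M`). [cite: KnuthTAOCP2, §3.4.2 Algorithm P] -/
theorem card_filter_fisherYates_mem_ge {N M : ℕ} (hN : 1 ≤ N) (hNM : N ≤ M)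
    (G : Finset (Perm (Fin N))) :
    (#G : ℝ) / N.factorial * (1 - (N : ℝ) ^ 2 / M) * (M : ℝ) ^ (N - 1) ≤
      #{ρ : Fin (N - 1) → Fin M | fisherYates N (coins ρ) ∈ G} := by
  classical
  -- fibrewise: `#{ρ | fy ρ ∈ G} = ∑_{τ ∈ G} #{ρ | fy ρ = τ} ≥ |G| · ∏ ⌊M/d⌋`
  set c : ℕ := ∏ i : Fin (N - 1), M / (N - i) with hc
  have hfib : #G * c ≤ #{ρ : Fin (N - 1) → Fin M | fisherYates N (coins ρ) ∈ G} := by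
    rw [Finset.card_eq_sum_card_fiberwise (f := fun ρ => fisherYates N (coins ρ)) (t := G)
      (fun ρ hρ => by simpa using hρ)]
    calc #G * c = ∑ τ ∈ G, c := by rw [Finset.sum_const, smul_eq_mul]
      _ ≤ _ := Finset.sum_le_sum fun τ hτ => ?_
    refine (le_card_fisherYates_fiber hN M τ).trans (Finset.card_le_card fun ρ hρ => ?_)
    simp only [Finset.mem_filter, Finset.mem_univ, true_and] at hρ ⊢
    exact ⟨by rw [hρ]; exact hτ, hρ⟩
  -- numerics: `c · N! ≥ (M-N)^{N-1} ≥ (1 - N²/M) M^{N-1}`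
  have hcN : ((M : ℝ) - N) ^ (N - 1) ≤ (N.factorial : ℝ) * c := by
    have h := pow_le_factorial_mul_prod_div hN hNM
    have h' : (((M - N) ^ (N - 1) : ℕ) : ℝ) ≤ ((N.factorial * c : ℕ) : ℝ) := by exact_mod_cast h
    rw [Nat.cast_pow, Nat.cast_sub hNM, Nat.cast_mul] at h'
    exact h'
  have hM : (0 : ℝ) < M := by exact_mod_cast (show 0 < M by omega)
  have hbern : (1 - (N : ℝ) ^ 2 / M) * (M : ℝ) ^ (N - 1) ≤ ((M : ℝ) - N) ^ (N - 1) := by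
    have e : ((M : ℝ) - N) ^ (N - 1) = (1 + (-(N : ℝ) / M)) ^ (N - 1) * (M : ℝ) ^ (N - 1) := by
      rw [← mul_pow]; congr 1; field_simp; ring
    rw [e]
    refine mul_le_mul_of_nonneg_right ?_ (by positivity)
    have hNM' : (N : ℝ) / M ≤ 1 := (div_le_one hM).2 (by exact_mod_cast hNM)
    have hb := one_add_mul_le_pow (a := -(N : ℝ) / M) (by rw [neg_div]; linarith) (N - 1)
    refine le_trans ?_ hb
    have hN1 : ((N - 1 : ℕ) : ℝ) ≤ N := by exact_mod_cast Nat.sub_le N 1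
    have hNn : (0 : ℝ) ≤ N := Nat.cast_nonneg N
    have key : ((N - 1 : ℕ) : ℝ) * N / M ≤ (N : ℝ) * N / M :=
      div_le_div_of_nonneg_right (mul_le_mul_of_nonneg_right hN1 hNn) hM.le
    have e1 : (1 : ℝ) + ((N - 1 : ℕ) : ℝ) * (-(N : ℝ) / M) = 1 - ((N - 1 : ℕ) : ℝ) * N / M := by
      ring
    have e2 : (1 : ℝ) - (N : ℝ) ^ 2 / M = 1 - (N : ℝ) * N / M := by ring
    rw [e1, e2]
    linarith
  have hfac : (0 : ℝ) < N.factorial := by exact_mod_cast Nat.factorial_pos N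
  calc (#G : ℝ) / N.factorial * (1 - (N : ℝ) ^ 2 / M) * (M : ℝ) ^ (N - 1)
      = (#G : ℝ) / N.factorial * ((1 - (N : ℝ) ^ 2 / M) * (M : ℝ) ^ (N - 1)) := by ring
    _ ≤ (#G : ℝ) / N.factorial * ((N.factorial : ℝ) * c) :=
        mul_le_mul_of_nonneg_left (hbern.trans hcN) (by positivity)
    _ = (#G * c : ℕ) := by push_cast; field_simp
    _ ≤ _ := by exact_mod_cast hfib

/-! ## Independent repetitions -/

/-- Among `Q`-tuples of blocks, those avoiding a set `S` in every coordinate number exactly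
`(|α| - |S|)^Q`. [folklore] -/
theorem card_forall_not_mem_pow {α : Type*} [Fintype α] [DecidableEq α] (S : Finset α) (Q : ℕ) :
    #{ρ : Fin Q → α | ∀ q, ρ q ∉ S} = (Fintype.card α - #S) ^ Q := by
  classical
  have : #{ρ : Fin Q → α | ∀ q, ρ q ∉ S} = Fintype.card (Fin Q → {a // a ∉ S}) := by
    rw [← Fintype.card_subtype]
    refine Fintype.card_congr ?_
    exact { toFun := fun ρ q => ⟨ρ.1 q, ρ.2 q⟩
            invFun := fun f => ⟨fun q => (f q).1, fun q => (f q).2⟩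
            left_inv := fun ρ => rfl
            right_inv := fun f => rfl }
  rw [this, Fintype.card_fun, Fintype.card_fin, Fintype.card_subtype_compl,
    Fintype.card_subtype]
  simp

/-- **Repetition amplifies a dense good set**: if `S` has density at least `θ` in `α`, then the
`Q`-tuples with some coordinate in `S` number at least `(1 - (1-θ)^Q) |α|^Q`. [folklore] -/
theorem card_exists_mem_ge {α : Type*} [Fintype α] [DecidableEq α] (S : Finset α) (Q : ℕ)
    {θ : ℝ} (hθ : θ * Fintype.card α ≤ #S) :
    (1 - (1 - θ) ^ Q) * (Fintype.card α : ℝ) ^ Q ≤ #{ρ : Fin Q → α | ∃ q, ρ q ∈ S} := by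
  classical
  have hsplit : #{ρ : Fin Q → α | ∃ q, ρ q ∈ S} + #{ρ : Fin Q → α | ∀ q, ρ q ∉ S} =
      Fintype.card α ^ Q := by
    have h := Finset.card_filter_add_card_filter_not (s := (Finset.univ : Finset (Fin Q → α)))
      (fun ρ => ∃ q, ρ q ∈ S)
    rw [Finset.card_univ, Fintype.card_fun, Fintype.card_fin] at h
    have hB : (Finset.univ.filter fun ρ : Fin Q → α => ¬ ∃ q, ρ q ∈ S) =
        ({ρ : Fin Q → α | ∀ q, ρ q ∉ S} : Finset _) := by
      ext ρ; simp
    rw [hB] at h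
    convert h using 2
  rw [card_forall_not_mem_pow] at hsplit
  have hS : #S ≤ Fintype.card α := S.card_le_univ
  have hα : (0 : ℝ) ≤ Fintype.card α := Nat.cast_nonneg _
  by_cases hcard : Fintype.card α = 0
  · simp only [hcard, Nat.cast_zero]
    rcases Nat.eq_zero_or_pos Q with rfl | hQ
    · simp
    · rw [zero_pow hQ.ne', mul_zero]; exact Nat.cast_nonneg _
  have hθ1 : θ ≤ 1 := by
    have hpos : (0 : ℝ) < Fintype.card α := by exact_mod_cast Nat.pos_of_ne_zero hcard
    have : θ * Fintype.card α ≤ Fintype.card α := hθ.trans (by exact_mod_cast hS)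
    nlinarith
  have hbad : (((Fintype.card α - #S) ^ Q : ℕ) : ℝ) ≤ ((1 - θ) * Fintype.card α) ^ Q := by
    push_cast [Nat.cast_sub hS]
    gcongr
    · exact_mod_cast sub_nonneg.2 (by exact_mod_cast hS : (#S : ℝ) ≤ Fintype.card α)
    · linarith
  have e : (#{ρ : Fin Q → α | ∃ q, ρ q ∈ S} : ℝ) =
      (Fintype.card α : ℝ) ^ Q - ((Fintype.card α - #S) ^ Q : ℕ) := by
    have := congrArg (fun n : ℕ => (n : ℝ)) hsplit
    push_cast at this ⊢
    linarith
  rw [e]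
  calc (1 - (1 - θ) ^ Q) * (Fintype.card α : ℝ) ^ Q
      = (Fintype.card α : ℝ) ^ Q - ((1 - θ) * Fintype.card α) ^ Q := by rw [mul_pow]; ring
    _ ≤ _ := by linarith

/-- `(1 - θ)^Q ≤ 1/3` as soon as `θ Q ≥ 2` (`θ ≤ 1`): `(1-θ)^Q ≤ e^{-θQ} ≤ e^{-2} < 1/3`.
[folklore] -/
theorem one_sub_pow_le_third {θ : ℝ} {Q : ℕ} (hθ1 : θ ≤ 1) (hQ : 2 ≤ θ * Q) :
    (1 - θ) ^ Q ≤ 1 / 3 := by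
  have hle : 1 - θ ≤ Real.exp (-θ) := by
    have := Real.add_one_le_exp (-θ); linarith
  have h1 : (1 - θ) ^ Q ≤ Real.exp (-θ) ^ Q := pow_le_pow_left₀ (by linarith) hle Q
  rw [← Real.exp_nat_mul] at h1
  have h2 : Real.exp (Q * -θ) ≤ Real.exp (-2) := Real.exp_le_exp.2 (by nlinarith)
  have h3 : Real.exp (-2) ≤ 1 / 3 := by
    rw [Real.exp_neg, inv_eq_one_div, one_div_le_one_div (Real.exp_pos 2) (by norm_num)]
    have := Real.quadratic_le_exp_of_nonneg (show (0:ℝ) ≤ 2 by norm_num)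
    linarith
  exact h1.trans (h2.trans h3)

end Literature.Combinatorics.Enumerative
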